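import Mathlib
import Literature.Probability.LatticeModels.ProdBernoulliIndependence
import Literature.Probability.LatticeModels.IsoradialPercolationProofs
import Literature.Probability.Percolation.PercolationProofs
import Literature.Probability.Percolation.Crossings
import Literature.Probability.Percolation.TreeGraphBound
import HarnessLib

/-!
# One finger is harmless — budget form (`stub_oneFinger_of_spreadSwitch`)

Helper for the crux `PercNearOneGluing.NoHeavyLowerTail` (item stmt-CriticalPhenomena-4575), line
`afree-cluster-pioneers`: proves exactly the registered stub `stub_oneFinger_of_spreadSwitch`, the
`|D| ≤ 1` piece of the cut of the bad event `{1 ≤ N < t}` by the number of pioneers, in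
OBSERVER-SIDE BUDGET FORM (no hub; per-point budgets `P(|blk a| < t) ≤ η`).  Lands with
`--supports stmt-CriticalPhenomena-4575`.  Template: the landed hub-form theorem
`stub_oneFingerHub` in `Theorems/PercNearOneGluingNoHeavyLowerTailOneFingerHub.lean`, whose
architecture is mirrored here.

## Statement

Finite weighted graph on `Fin n`, `P = prodBernoulli w` (independent edges), relay set `A`,
observer `o ∉ A`, a level `t` and a budget `η ≥ 0` with `P(|blk a| < t) ≤ η` for every `a ∈ A`,
where `blk a (ω) = {a' ∈ A | a ↔ a'}` is the block of `a`.  Write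
`N(ω) = |{a ∈ A | o ↔ a}| = |C(o) ∩ A|` and let the PIONEERS of `ω` be
`D(ω) = {a ∈ A | ω ∈ openConnIn (Aᶜ ∪ {o, a}) o a}` (relay points reached from `o` by an open
path whose other vertices avoid `A`).  Assuming the spread switch (first hypothesis; it is the
landed sibling `stub_spreadSwitch`), the event "`1 ≤ N(ω)`, `N(ω) < t` and `|D(ω)| ≤ 1`" has
probability at most `η + 2 √P(o ↮ A)`, where `{o ↮ A} = (⋃ a ∈ A, {o ↔ a})ᶜ`.

## Proof

* (first entrance) An open walk from `o` to a point of `A` has a first vertex `a` in `A`; the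
  initial segment up to `a` witnesses `a ∈ D(ω)`.  So on the event (`N ≥ 1`) a pioneer exists and
  `|D| ≤ 1` forces `D(ω) = {a}`; moreover `o ↔ a`, so by symmetry and transitivity of open
  connection `{a' ∈ A | o ↔ a'} = {a' ∈ A | a ↔ a'} = blk a (ω)`, i.e. `N = |blk a|` and
  `N < t` reads `|blk a| < t`.  Hence the event is covered by the parts
  `Q_a = {D = {a}} ∩ {|blk a| < t}` (`a ∈ A`), each of probability `≤ P(|blk a| < t) ≤ η`.
* (meets) The `Q_a` are pairwise disjoint, and `D` is monotone in the configuration (each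
  restricted connection event is increasing, `isUpperSet_openConnIn`), so the meet `ω ∩ ω'` of
  `ω ∈ Q_a`, `ω' ∈ Q_b` (`a ≠ b`) has `D(ω ∩ ω') ⊆ {a} ∩ {b} = ∅`, i.e. lies in `Z = {D = ∅}`;
  and `Z ⊆ {o ↮ A}` by the first-entrance argument.
* (spread switch) Index the parts by `Fin |A|` through `A.equivFin`; then
  `P(event) ≤ P(⋃_a Q_a) ≤ ∑_a P(Q_a) ≤ η + 2 √P(Z) ≤ η + 2 √P(o ↮ A)`.

Sources: [folklore] (first-entrance decomposition; card afree-cluster-pioneers of the line).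
-/

namespace Summit.CriticalPhenomena.PercolationContinuityZ3.Theorems

open scoped BigOperators Classical
open MeasureTheory Literature.Probability.LatticeModels Literature.Probability.Percolation

/-- First entrance of a walk into a vertex set: a walk from `u` to a vertex of `A` has an initial
segment ending at some `a ∈ A` all of whose vertices other than `u` and `a` lie outside `A`.
[folklore] -/
private theorem ofb_exists_walk_firstMem {V : Type*} {G : SimpleGraph V} (A : Set V) {u v : V}
    (p : G.Walk u v) (hv : v ∈ A) :
    ∃ a ∈ A, ∃ q : G.Walk u a, ∀ x ∈ q.support, x ∈ A → x = u ∨ x = a := by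
  -- adapted from `nhlt_exists_walk_firstMem` (Theorems/PercNearOneGluingNoHeavyLowerTailOneFingerHub)
  induction p with
  | @nil u => exact ⟨u, hv, SimpleGraph.Walk.nil, fun x hx _ => Or.inl (by simpa using hx)⟩
  | @cons u u₁ v h p ih =>
    by_cases hu : u ∈ A
    · exact ⟨u, hu, SimpleGraph.Walk.nil, fun x hx _ => Or.inl (by simpa using hx)⟩
    obtain ⟨a, ha, q, hq⟩ := ih hv
    by_cases hu₁ : u₁ ∈ A
    · refine ⟨u₁, hu₁, SimpleGraph.Walk.cons h SimpleGraph.Walk.nil, fun x hx _ => ?_⟩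
      simpa using hx
    · refine ⟨a, ha, SimpleGraph.Walk.cons h q, fun x hx hxA => ?_⟩
      rw [SimpleGraph.Walk.support_cons, List.mem_cons] at hx
      rcases hx with rfl | hx
      · exact Or.inl rfl
      · rcases hq x hx hxA with rfl | rfl
        · exact absurd hxA hu₁
        · exact Or.inr rfl

/-- **Pioneers exist.** If `o` is joined by an open path to a relay point `a ∈ A`, then some
`a' ∈ A` is a pioneer: `o` is joined to `a'` by an open path all of whose vertices lie in
`Aᶜ ∪ {o, a'}` (take the first vertex of the path lying in `A`). [folklore] -/
private theorem ofb_exists_pioneer {n : ℕ} (A : Finset (Fin n)) (o : Fin n) {a : Fin n}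
    {ω : BondConfig (Fin n)} (ha : a ∈ A) (h : ω ∈ openConn o a) :
    ∃ a' ∈ A, ω ∈ openConnIn ((↑A : Set (Fin n))ᶜ ∪ {o, a'}) o a' := by
  -- adapted from `nhlt_exists_pioneer` (Theorems/PercNearOneGluingNoHeavyLowerTailOneFingerHub)
  have h' : (openGraph ω).Reachable o a := h
  obtain ⟨p⟩ := h'
  obtain ⟨a', ha', q, hq⟩ := ofb_exists_walk_firstMem (↑A : Set (Fin n)) p (Finset.mem_coe.2 ha)
  refine ⟨a', Finset.mem_coe.1 ha', mem_openConnIn_iff_exists_openWalk.2 ⟨q, fun v hv => ?_⟩⟩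
  simp only [Set.mem_union, Set.mem_compl_iff, Finset.mem_coe, Set.mem_insert_iff,
    Set.mem_singleton_iff]
  by_cases hvA : v ∈ A
  · exact Or.inr (hq v hv (Finset.mem_coe.2 hvA))
  · exact Or.inl hvA

/-- Registered stub `stub_oneFinger_of_spreadSwitch` of crux stmt-CriticalPhenomena-4575 (line
afree-cluster-pioneers): **one finger is harmless, observer-side budget form.**  Assuming the
spread switch (first hypothesis): for an observer `o ∉ A`, a level `t` and a budget `0 ≤ η` with
`P(|blk a| < t) ≤ η` for every `a ∈ A` (`blk a = {a' ∈ A | a ↔ a'}`), the event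
"`1 ≤ N < t` and `o` has at most one pioneer" — `N = |{a ∈ A | o ↔ a}|`, pioneers
`D(ω) = {a ∈ A | ω ∈ openConnIn (Aᶜ ∪ {o, a}) o a}` — has probability
`≤ η + 2 √P(o ↮ A)`.  Proof: the first vertex in `A` of an open `o → A` path is a pioneer, so on
the event `D = {a}` with `o ↔ a`, whence `N = |blk a| < t`; the parts
`Q_a = {D = {a}} ∩ {|blk a| < t}` are pairwise disjoint with meets in `{D = ∅} ⊆ {o ↮ A}` (`D` is
monotone), and the spread switch gives `∑_a P(Q_a) ≤ η + 2 √P(D = ∅)`; see the module docstring.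
[folklore] -/
theorem stub_oneFinger_of_spreadSwitch :
    (∀ (n L : ℕ) (w : Sym2 (Fin n) → unitInterval) (Q : Fin L → Set (BondConfig (Fin n)))
      (Z : Set (BondConfig (Fin n))) (m : ℝ),
      0 ≤ m →
      (∀ i j, i ≠ j → Disjoint (Q i) (Q j)) →
      (∀ i j, i ≠ j → ∀ ω ∈ Q i, ∀ ω' ∈ Q j, ω ∩ ω' ∈ Z) →
      (∀ i, (prodBernoulli w).real (Q i) ≤ m) →
      ∑ i, (prodBernoulli w).real (Q i) ≤ m + 2 * Real.sqrt ((prodBernoulli w).real Z)) →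
    ∀ (n : ℕ) (w : Sym2 (Fin n) → unitInterval) (A : Finset (Fin n)) (o : Fin n) (t η : ℝ),
      o ∉ A → 0 ≤ η →
      (∀ a ∈ A, (prodBernoulli w).real
          {ω | ((A.filter fun a' => ω ∈ openConn a a').card : ℝ) < t} ≤ η) →
      (prodBernoulli w).real
          {ω | 1 ≤ (A.filter fun a => ω ∈ openConn o a).card ∧
               ((A.filter fun a => ω ∈ openConn o a).card : ℝ) < t ∧
               (A.filter fun a => ω ∈ openConnIn ((↑A : Set (Fin n))ᶜ ∪ {o, a}) o a).card ≤ 1} ≤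
        η + 2 * Real.sqrt ((prodBernoulli w).real (⋃ a ∈ A, openConn o a)ᶜ) := by
  intro hSS n w A o t η _ho hη0 hη
  -- the pioneer set `D ω`
  set D : BondConfig (Fin n) → Finset (Fin n) :=
    fun ω => A.filter fun a => ω ∈ openConnIn ((↑A : Set (Fin n))ᶜ ∪ {o, a}) o a with hD
  have hDmem : ∀ {ω : BondConfig (Fin n)} {a : Fin n},
      a ∈ D ω ↔ a ∈ A ∧ ω ∈ openConnIn ((↑A : Set (Fin n))ᶜ ∪ {o, a}) o a :=
    fun {ω a} => Finset.mem_filter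
  -- `D` is monotone in the configuration
  have hDmono : ∀ {ω ω' : BondConfig (Fin n)}, ω ⊆ ω' → D ω ⊆ D ω' := by
    intro ω ω' hle a ha
    rw [hDmem] at ha ⊢
    exact ⟨ha.1, isUpperSet_openConnIn _ o a hle ha.2⟩
  -- `D ω` is nonempty as soon as `o` is joined to a relay point
  have hDne : ∀ {ω : BondConfig (Fin n)} {a : Fin n}, a ∈ A → ω ∈ openConn o a →
      (D ω).Nonempty := by
    intro ω a ha h
    obtain ⟨a', ha', h'⟩ := ofb_exists_pioneer A o ha h
    exact ⟨a', hDmem.2 ⟨ha', h'⟩⟩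
  -- the parts `Q_a = {D = {a}} ∩ {|blk a| < t}`, indexed by `Fin |A|`, and the zone `Z = {D = ∅}`
  set e : Fin A.card ≃ {x // x ∈ A} := A.equivFin.symm with he
  set Q : Fin A.card → Set (BondConfig (Fin n)) :=
    fun i => {ω | D ω = {(e i : Fin n)} ∧
      ((A.filter fun a' => ω ∈ openConn (e i : Fin n) a').card : ℝ) < t} with hQ
  set Z : Set (BondConfig (Fin n)) := {ω | D ω = ∅} with hZ
  have hdisj : ∀ i j, i ≠ j → Disjoint (Q i) (Q j) := by
    intro i j hij
    refine Set.disjoint_left.2 fun ω hi hj => hij ?_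
    have h1 : ({(e i : Fin n)} : Finset (Fin n)) = {(e j : Fin n)} := hi.1.symm.trans hj.1
    exact e.injective (Subtype.ext (Finset.singleton_inj.1 h1))
  have hmeet : ∀ i j, i ≠ j → ∀ ω ∈ Q i, ∀ ω' ∈ Q j, ω ∩ ω' ∈ Z := by
    intro i j hij ω hω ω' hω'
    change D (ω ∩ ω') = ∅
    refine Finset.eq_empty_of_forall_notMem fun x hx => hij ?_
    have hxi : x ∈ D ω := hDmono Set.inter_subset_left hx
    have hxj : x ∈ D ω' := hDmono Set.inter_subset_right hx
    rw [hω.1, Finset.mem_singleton] at hxi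
    rw [hω'.1, Finset.mem_singleton] at hxj
    exact e.injective (Subtype.ext (hxi.symm.trans hxj))
  have hQm : ∀ i, (prodBernoulli w).real (Q i) ≤ η := fun i =>
    le_trans (measureReal_mono fun ω hω => hω.2) (hη (e i) (e i).2)
  have hsum := hSS n A.card w Q Z η hη0 hdisj hmeet hQm
  -- `Z ⊆ {o ↮ A}`
  have hZle : (prodBernoulli w).real Z ≤ (prodBernoulli w).real (⋃ a ∈ A, openConn o a)ᶜ := by
    refine measureReal_mono fun ω hω => ?_
    rw [Set.mem_compl_iff, Set.mem_iUnion₂]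
    rintro ⟨a, ha, h⟩
    exact (hDne ha h).ne_empty hω
  -- the event is covered by the parts
  have hEsub : {ω : BondConfig (Fin n) | 1 ≤ (A.filter fun a => ω ∈ openConn o a).card ∧
      ((A.filter fun a => ω ∈ openConn o a).card : ℝ) < t ∧
      (A.filter fun a => ω ∈ openConnIn ((↑A : Set (Fin n))ᶜ ∪ {o, a}) o a).card ≤ 1} ⊆
      ⋃ i, Q i := by
    rintro ω ⟨h1, ht, h2⟩
    change (D ω).card ≤ 1 at h2
    obtain ⟨a, ha⟩ := Finset.card_pos.1 h1
    rw [Finset.mem_filter] at ha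
    obtain ⟨a', ha'⟩ := hDne ha.1 ha.2
    have hDω : D ω = {a'} :=
      Finset.eq_singleton_iff_unique_mem.2 ⟨ha', fun x hx => Finset.card_le_one.1 h2 x hx a' ha'⟩
    have ha'A : a' ∈ A := (hDmem.1 ha').1
    have hoa' : (openGraph ω).Reachable o a' := openConnIn_subset_openConn _ o a' (hDmem.1 ha').2
    -- `blk a' = {a ∈ A | o ↔ a}` on the event
    have hblk : (A.filter fun a'' => ω ∈ openConn a' a'') = A.filter fun a'' => ω ∈ openConn o a'' := by
      refine Finset.filter_congr fun x _ => ?_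
      change (openGraph ω).Reachable a' x ↔ (openGraph ω).Reachable o x
      exact ⟨fun h => hoa'.trans h, fun h => hoa'.symm.trans h⟩
    have ht' : ((A.filter fun a'' => ω ∈ openConn a' a'').card : ℝ) < t := by
      rw [hblk]; exact ht
    refine Set.mem_iUnion.2 ⟨e.symm ⟨a', ha'A⟩, ?_⟩
    have hei : (e (e.symm ⟨a', ha'A⟩) : Fin n) = a' := by rw [Equiv.apply_symm_apply]
    change D ω = {(e (e.symm ⟨a', ha'A⟩) : Fin n)} ∧
      ((A.filter fun a'' => ω ∈ openConn (e (e.symm ⟨a', ha'A⟩) : Fin n) a'').card : ℝ) < t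
    rw [hei]
    exact ⟨hDω, ht'⟩
  calc (prodBernoulli w).real
        {ω : BondConfig (Fin n) | 1 ≤ (A.filter fun a => ω ∈ openConn o a).card ∧
          ((A.filter fun a => ω ∈ openConn o a).card : ℝ) < t ∧
          (A.filter fun a => ω ∈ openConnIn ((↑A : Set (Fin n))ᶜ ∪ {o, a}) o a).card ≤ 1}
      ≤ (prodBernoulli w).real (⋃ i, Q i) := measureReal_mono hEsub
    _ ≤ ∑ i, (prodBernoulli w).real (Q i) := measureReal_iUnion_fintype_le _
    _ ≤ η + 2 * Real.sqrt ((prodBernoulli w).real Z) := hsum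
    _ ≤ η + 2 * Real.sqrt ((prodBernoulli w).real (⋃ a ∈ A, openConn o a)ᶜ) := by
        have h := Real.sqrt_le_sqrt hZle
        linarith

end Summit.CriticalPhenomena.PercolationContinuityZ3.Theorems
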